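/-
Copyright (c) 2026 the pub-hodgecm-mathlib formalisation cell (harness21).  Prover seat hodgecm-mathlib-F0P3a-p01 (g32), req620 Track A «(D-RAM) FOUR-FRAME» squad
(unit U3_Laws, (KMS) road «MODULO κ-STAGE B», brick κB-T tv = 2 TWIN «T-STRATA κ-SOCKETS, TYPE 2», FILE 1₂∕3₂: THE EXPLICIT TYPE-2 POLARISATIONS OF THE SPLIT LATTICES;
dealer LH4-plan (g11) WORD #44 (1); head letters F0P3a-p01 (g32) 2026-09-04T02:00:51Z; type-0 template ★ `F0P3cDyRamDiagonalKappaSplitCountValues` (LH4-p04 (g2)) VERBATIM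
up to the parity of `s` and the window).  2026-09-04.
-/
import Summits.HodgeConjecture.HodgeConjecture.Theorems.F0P3cDyRamDiagonalKappaSplitCountEval      -- ★ κB-T FILE 1 (LH4-p04): `chiVec_zero∕one∕two`, `normSign_mul_self`, `normSign_normVarpi_pow_inv`, `normSign_neg_polarisation_entry`; brings ★ Fκ2∕Fκ1 (LH4-p05: `kappaCount_eq_cosetKappa_of_hcoset`, `cosetKappa_coset_eq_of_dichotomy`), ★ B4 (S_F of the split lattices), ★ LocalFields (`exists_fixed_unit_not_norm_of_level_pow`, `normSign_eq_of_near`, `isAdicComplete_valuedInteger_of_completeSpace`, `exists_nonnorm_dichotomy_of_isRamifiedQuadraticDatum`)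
import Summits.HodgeConjecture.HodgeConjecture.Theorems.F0P3cDyRamDiagonalSplitCountTwoUnique      -- ★ B9-0₂ (LH4-p13): `typeTwoPolarisation_unique_latt_axis3` (one `S_F`-coset of type-2 polarisations on `M₃(s,x)`)
import Summits.HodgeConjecture.HodgeConjecture.Theorems.F0P3cDyRamDiagonalSplitCountTwoUniqueAxisOne   -- ★ B9-0₂ (LH4-p13): `typeTwoPolarisation_unique_latt_axis1`
import Summits.HodgeConjecture.HodgeConjecture.Theorems.F0P3cDyRamDiagonalSplitCountTwoUniqueAxisTwo   -- ★ B9-0₂ (LH4-p13): `typeTwoPolarisation_unique_latt_axis2`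
import Summits.HodgeConjecture.HodgeConjecture.Theorems.F0P3cDyRamDiagonalSplitCountTwoTools       -- ★ B4₂ FILE 1 (LH4-p13): `isVertexLattice_two_of_gram_eq_block₁∕₂∕₃`
import Summits.HodgeConjecture.HodgeConjecture.Theorems.F0P3cDyRamDiagonalPolarisationCoset        -- ★ (3b) (LH4-p11): `isVertexLattice_diagonal_iff_of_unique` (uniqueness ⇒ the `hcoset` shape)
import HarnessLib

/-!
# Crux `H413`, line LH4 «(D-RAM) FOUR-FRAME» road — unit U3_Laws (iii), (KMS) road «MODULO κ-STAGE B», brick κB-T tv = 2 TWIN, FILE 1₂∕3₂: THE EXPLICIT TYPE-2 POLARISATIONS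
# `diag(−xσx·π₀^{−j}, π₀^{−j}, 1)` etc. of the split lattices `M_k(2j+1,·)` (the witnesses of ★ B4₂ `isTypeTwoPolarisable_latt_axisN`, forms named)

Cell `hodgecm-mathlib` (D-0151), FLOOR 0, crux item H413 = `stmt-HodgeConjecture-24833`, route of record `HCCMUnconditional`; squad F0∕P3c∕LH4 (req618∕req620); registered stub served:
`F0P3cDyRamFourFrameU3.stub_U3_kappaModelSum` (KMS; tree `Cruxes/H413/Lines/F0_P3c_DyRamFourFrame_U3_Laws.lean` ED. 8 :457), type-2 half (`hBκ10₂`: `kappaCount σ ϖ 2` over the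
type-2-polarisable part of `𝓛₀(T)`).  THEOREMS ONLY (no `def`, no instance, no notation, no `sorry`, default heartbeats); lane `--supports stmt-HodgeConjecture-24833 --as helper`
(count-neutral).  FILE 3₂ `…DiagonalKappaSplitCountTwoSockets` sums these values over the three type-2 T-strata `stratumTwo σ ϖ T (s,s,0)∕(0,s,s)∕(s,0,s)` (★ StrataDefs ED. 2).

THE MATHEMATICS (LH4-p05 (g3) PLAN v1 §4 «on-branch», type-2 column = the type-0 file's argument with ONE change).  For ODD `s = 2j+1` and a unit `x`, `M₃(s,x) =
latt (1 0 0; x ϖ^s 0; 0 0 1)` is a type-2 vertex lattice for `D₁ = (−xσx·π₀^{−j}, π₀^{−j}, 1)`, `π₀ = ϖσϖ` (★ B4₂ (T₃²·a), re-exported with `D₁` explicit); its type-2 polarisations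
are ONE `S_F`-coset (★ B9-0₂), so ★ Fκ2 gives `kappaCount σ ϖ 2 i M₃ = χ_i(D₁)·[χ_i ≡ 1 on S_F]` under the index-two dichotomy (non-norm unit `c`, complete `K`), with
`S_F(M₃) = {u ∈ 𝒰^σ : |u₁ − u₀| ≤ |ϖ^s|}` (★ B4).  THE CHANGE: `u₁∕u₀` is `σ`-fixed, so `|u₁∕u₀ − 1| ≤ |ϖ|^s` with `s` odd means `≤ |ϖ|^{s+1}`: (ALIVE) `2d ≤ s + 1` ⇒ `ω(u₁) = ω(u₀)`
on `S_F` (★ `normSign_eq_of_near`, hypothesis `2d − 1 ≤ s`) ⇒ `κ_2 = χ_2(D₁) = ω(−1)`; (DEAD FOOT) `s + 3 ≤ 2d` ⇒ the level-`(j+1)` fixed non-norm `u₀` (★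
`exists_fixed_unit_not_norm_of_level_pow`, `|u₀ − 1| ≤ |ϖ|^{2j+2} ≤ |ϖ|^s`) puts `(1, u₀, 1) ∈ S_F` with `χ_2 = −1` ⇒ `κ_2 = 0`; (DEAD OFF-FOOT) `(1,1,c) ∈ S_F`, `χ_0 = χ_1 = ω(c) = −1`.
Axes 1, 2: slots permuted (★ B4₂ (T₁²·a)∕(T₂²·a)).  No type-2 core (`𝒪³` is not type-2 polarisable; B10₂ has no core cell).

WHAT IS PROVED here (generic valued field): `isVertexLattice_two_latt_axis1∕2∕3` — the explicit type-2 polarisations (★ B4₂'s witnesses, proofs verbatim with the form named), consumed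
by FILE 2₂ `…DiagonalKappaSplitCountTwoValues` (`kappaCount_two_latt_axisN`, window `2 * d ≤ s + 1`) and FILE 3₂ `…Sockets` (the three `stratumTwo` κ-sockets).
HONEST LABEL.  Count-neutral (`--supports`); nothing printed is asserted; (KMS) stays a PROVER TARGET (empirical census law in diagonal-model currency); `HC_CM` is proved only modulo
the 7 printed citations (2 remaining named inputs: hLiu418 = `stmt-HodgeConjecture-24832`, h413 = `stmt-HodgeConjecture-24833`) until rung 0 closes.

## References
* [Kottwitz1986BaseChangeUnits] R. E. Kottwitz, *Base change for unit elements of Hecke algebras*, Compositio Math. 60 (1986), §1 pp. 240–241 (κ-orbital integrals of units as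
  signed lattice counts modulo the torus).
* [Rogawski1990] J. D. Rogawski, *Automorphic Representations of Unitary Groups in Three Variables*, Ann. of Math. Stud. 123 (1990), §4.9 Prop. 4.9.1 (a) p. 55, §4.10 p. 58.
* [Serre1979] J.-P. Serre, *Local Fields*, GTM 67 (1979), Ch. V §3 Prop. 5, Cor. 3 (norms on the unit filtration; the conductor of a ramified quadratic extension).
* [Jacobowitz1962] R. Jacobowitz, *Hermitian forms over local fields*, Amer. J. Math. 84 (1962), §7–§8 (`𝔭`-modular lattices, Gram matrices).
-/

set_option autoImplicit false

noncomputable section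

namespace Summit.HodgeConjecture.HodgeConjecture.Cruxes.H413.F0P3cDyRamDiagonalKappaSplitCountTwoEval

open Matrix
open Literature.NumberTheory.Automorphic Literature.NumberTheory.Automorphic.HermitianLattice
open Literature.NumberTheory.Automorphic.UnitaryLatticeTree Literature.NumberTheory.Automorphic.UnitaryThreeFourFrame
open Literature.NumberTheory.LocalFields Literature.NumberTheory.LocalFields.WildQuadraticDatum
open Summit.HodgeConjecture.HodgeConjecture.Cruxes.H413.F0P3cDyRamDiagonalTorusDefs
open Summit.HodgeConjecture.HodgeConjecture.Cruxes.H413.F0P3cDyRamDiagonalStrataDefs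
open Summit.HodgeConjecture.HodgeConjecture.Cruxes.H413.F0P3cDyRamDiagonalKappaCountDefs
open Summit.HodgeConjecture.HodgeConjecture.Cruxes.H413.F0P3cDyRamDiagonalKappaCountEval
open Summit.HodgeConjecture.HodgeConjecture.Cruxes.H413.F0P3cDyRamStableSumSignClasses (normSign_eq_one_or)
open Summit.HodgeConjecture.HodgeConjecture.Cruxes.H413.F0P3cDyRamFixedCountDiagonalModel (normSign_mul_norm)
open Summit.HodgeConjecture.HodgeConjecture.Cruxes.H413.F0P3cDyRamDiagonalStratumTools
open Summit.HodgeConjecture.HodgeConjecture.Cruxes.H413.F0P3cDyRamDiagonalGluedTubeCriterion (formCongr_hnf_diagonal)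
open Summit.HodgeConjecture.HodgeConjecture.Cruxes.H413.F0P3cDyRamDiagonalCoreUnique
open Summit.HodgeConjecture.HodgeConjecture.Cruxes.H413.F0P3cDyRamDiagonalSplitCount
open Summit.HodgeConjecture.HodgeConjecture.Cruxes.H413.F0P3cDyRamDiagonalSplitCountAxisOne
open Summit.HodgeConjecture.HodgeConjecture.Cruxes.H413.F0P3cDyRamDiagonalSplitCountAxisTwo
open Summit.HodgeConjecture.HodgeConjecture.Cruxes.H413.F0P3cDyRamDiagonalSplitCountTwoTools
open Summit.HodgeConjecture.HodgeConjecture.Cruxes.H413.F0P3cDyRamDiagonalSplitCountTwoUnique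
open Summit.HodgeConjecture.HodgeConjecture.Cruxes.H413.F0P3cDyRamDiagonalSplitCountTwoUniqueAxisOne
open Summit.HodgeConjecture.HodgeConjecture.Cruxes.H413.F0P3cDyRamDiagonalSplitCountTwoUniqueAxisTwo
open Summit.HodgeConjecture.HodgeConjecture.Cruxes.H413.F0P3cDyRamDiagonalPolarisationCoset (isVertexLattice_diagonal_iff_of_unique)
open Summit.HodgeConjecture.HodgeConjecture.Cruxes.H413.F0P3cDyRamDiagonalKappaSplitCountEval
open scoped Valued WithZero Matrix MatrixGroups

variable {K : Type} [Field K] [Valued K ℤᵐ⁰]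

/-! ## §0  The explicit type-2 polarisations of the three split lattices (odd depth `s = 2j+1`) -/

/-- **(T₁²·a) EXPLICIT** — for a unit `z` and `s = 2j+1`, the axis-1 split lattice is a TYPE-2 vertex lattice for `diag ![1, -(σ z * ((ϖ * σ ϖ) ^ j)⁻¹ * z), ((ϖ * σ ϖ) ^ j)⁻¹]` (the witness of ★
`isTypeTwoPolarisable_latt_axis1`, same proof with the form named). [cite: Jacobowitz1962, §7–§8] [cite: Rogawski1990, §4.9 Prop. 4.9.1 (a) p. 55] -/
theorem isVertexLattice_two_latt_axis1 {σ : K →+* K} (hvσ : ∀ a, Valued.v (σ a) = Valued.v a)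
    {ϖ : K} (hϖ : Valued.v ϖ = WithZero.exp (-1 : ℤ)) {z : K} (hz : Valued.v z = 1) (j : ℕ) :
    IsVertexLattice σ ϖ (Matrix.diagonal (![1, -(σ z * ((ϖ * σ ϖ) ^ j)⁻¹ * z), ((ϖ * σ ϖ) ^ j)⁻¹] : Fin 3 → K)) 2 (latt (!![1, 0, 0; 0, 1, 0; 0, z, ϖ ^ (2 * j + 1)] : Matrix (Fin 3) (Fin 3) K)) := by
  have hϖ0 : ϖ ≠ 0 := fun h0 => by rw [h0, map_zero] at hϖ; exact WithZero.coe_ne_zero hϖ.symm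
  have hϖ1 : Valued.v ϖ ≤ 1 := by rw [hϖ, ← WithZero.exp_zero, WithZero.exp_le_exp]; norm_num
  have hvϖ0 : Valued.v ϖ ≠ 0 := (Valuation.ne_zero_iff _).2 hϖ0
  have hvd₁p : Valued.v (((ϖ * σ ϖ) ^ j)⁻¹ : K) * Valued.v (ϖ ^ (2 * j + 1)) = Valued.v ϖ := by
    rw [map_inv₀, map_pow, map_mul, hvσ, ← sq, map_pow, ← pow_mul, pow_succ, ← mul_assoc, inv_mul_cancel₀ (pow_ne_zero _ hvϖ0), one_mul]
  have hG : formCongr σ (Matrix.GeneralLinearGroup.mkOfDetNeZero _ (det_axis1_ne_zero hϖ0 z (2 * j + 1))) (Matrix.diagonal ![1, -(σ z * ((ϖ * σ ϖ) ^ j)⁻¹ * z), ((ϖ * σ ϖ) ^ j)⁻¹]) =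
      !![1, 0, 0; 0, 0, σ z * ((ϖ * σ ϖ) ^ j)⁻¹ * ϖ ^ (2 * j + 1); 0, σ (ϖ ^ (2 * j + 1)) * ((ϖ * σ ϖ) ^ j)⁻¹ * z, σ (ϖ ^ (2 * j + 1)) * ((ϖ * σ ϖ) ^ j)⁻¹ * ϖ ^ (2 * j + 1)] := by
    rw [formCongr_hnf_diagonal σ _ 0 0 z 1 (ϖ ^ (2 * j + 1)) _ rfl]
    ext i k
    fin_cases i <;> fin_cases k <;> simp
  refine isVertexLattice_two_of_gram_eq_block₁ hϖ0 hϖ1 _ hG ?_ ?_ ?_ (map_one _)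
  · rw [map_mul, map_mul, hvσ, hz, one_mul, hvd₁p]
  · rw [map_mul, map_mul, hvσ, hz, mul_one, mul_comm, hvd₁p]
  · rw [map_mul, map_mul, hvσ, mul_comm (Valued.v (ϖ ^ (2 * j + 1))) (Valued.v (((ϖ * σ ϖ) ^ j)⁻¹ : K)), mul_assoc, mul_comm (Valued.v (ϖ ^ (2 * j + 1))),
      ← mul_assoc, hvd₁p, map_pow]
    exact mul_le_of_le_one_right' (pow_le_one' hϖ1 _)

/-- **(T₂²·a) EXPLICIT** — for a unit `y` and `s = 2j+1`, the axis-2 split lattice is a TYPE-2 vertex lattice for `diag ![-(σ y * ((ϖ * σ ϖ) ^ j)⁻¹ * y), 1, ((ϖ * σ ϖ) ^ j)⁻¹]` (the witness of ★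
`isTypeTwoPolarisable_latt_axis2`, same proof with the form named). [cite: Jacobowitz1962, §7–§8] [cite: Rogawski1990, §4.9 Prop. 4.9.1 (a) p. 55] -/
theorem isVertexLattice_two_latt_axis2 {σ : K →+* K} (hvσ : ∀ a, Valued.v (σ a) = Valued.v a)
    {ϖ : K} (hϖ : Valued.v ϖ = WithZero.exp (-1 : ℤ)) {y : K} (hy : Valued.v y = 1) (j : ℕ) :
    IsVertexLattice σ ϖ (Matrix.diagonal (![-(σ y * ((ϖ * σ ϖ) ^ j)⁻¹ * y), 1, ((ϖ * σ ϖ) ^ j)⁻¹] : Fin 3 → K)) 2 (latt (!![1, 0, 0; 0, 1, 0; y, 0, ϖ ^ (2 * j + 1)] : Matrix (Fin 3) (Fin 3) K)) := by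
  have hϖ0 : ϖ ≠ 0 := fun h0 => by rw [h0, map_zero] at hϖ; exact WithZero.coe_ne_zero hϖ.symm
  have hϖ1 : Valued.v ϖ ≤ 1 := by rw [hϖ, ← WithZero.exp_zero, WithZero.exp_le_exp]; norm_num
  have hvϖ0 : Valued.v ϖ ≠ 0 := (Valuation.ne_zero_iff _).2 hϖ0
  have hvd₁p : Valued.v (((ϖ * σ ϖ) ^ j)⁻¹ : K) * Valued.v (ϖ ^ (2 * j + 1)) = Valued.v ϖ := by
    rw [map_inv₀, map_pow, map_mul, hvσ, ← sq, map_pow, ← pow_mul, pow_succ, ← mul_assoc, inv_mul_cancel₀ (pow_ne_zero _ hvϖ0), one_mul]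
  have hG : formCongr σ (Matrix.GeneralLinearGroup.mkOfDetNeZero _ (det_axis2_ne_zero hϖ0 y (2 * j + 1))) (Matrix.diagonal ![-(σ y * ((ϖ * σ ϖ) ^ j)⁻¹ * y), 1, ((ϖ * σ ϖ) ^ j)⁻¹]) =
      !![0, 0, σ y * ((ϖ * σ ϖ) ^ j)⁻¹ * ϖ ^ (2 * j + 1); 0, 1, 0; σ (ϖ ^ (2 * j + 1)) * ((ϖ * σ ϖ) ^ j)⁻¹ * y, 0, σ (ϖ ^ (2 * j + 1)) * ((ϖ * σ ϖ) ^ j)⁻¹ * ϖ ^ (2 * j + 1)] := by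
    rw [formCongr_hnf_diagonal σ _ 0 y 0 1 (ϖ ^ (2 * j + 1)) _ rfl]
    ext i k
    fin_cases i <;> fin_cases k <;> simp
  refine isVertexLattice_two_of_gram_eq_block₂ hϖ0 hϖ1 _ hG ?_ ?_ ?_ (map_one _)
  · rw [map_mul, map_mul, hvσ, hy, one_mul, hvd₁p]
  · rw [map_mul, map_mul, hvσ, hy, mul_one, mul_comm, hvd₁p]
  · rw [map_mul, map_mul, hvσ, mul_comm (Valued.v (ϖ ^ (2 * j + 1))) (Valued.v (((ϖ * σ ϖ) ^ j)⁻¹ : K)), mul_assoc, mul_comm (Valued.v (ϖ ^ (2 * j + 1))),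
      ← mul_assoc, hvd₁p, map_pow]
    exact mul_le_of_le_one_right' (pow_le_one' hϖ1 _)

/-- **(T₃²·a) EXPLICIT** — for a unit `x` and `s = 2j+1`, the axis-3 split lattice is a TYPE-2 vertex lattice for `diag ![-(σ x * ((ϖ * σ ϖ) ^ j)⁻¹ * x), ((ϖ * σ ϖ) ^ j)⁻¹, 1]` (the witness of ★
`isTypeTwoPolarisable_latt_axis3`, same proof with the form named). [cite: Jacobowitz1962, §7–§8] [cite: Rogawski1990, §4.9 Prop. 4.9.1 (a) p. 55] -/
theorem isVertexLattice_two_latt_axis3 {σ : K →+* K} (hvσ : ∀ a, Valued.v (σ a) = Valued.v a)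
    {ϖ : K} (hϖ : Valued.v ϖ = WithZero.exp (-1 : ℤ)) {x : K} (hx : Valued.v x = 1) (j : ℕ) :
    IsVertexLattice σ ϖ (Matrix.diagonal (![-(σ x * ((ϖ * σ ϖ) ^ j)⁻¹ * x), ((ϖ * σ ϖ) ^ j)⁻¹, 1] : Fin 3 → K)) 2 (latt (!![1, 0, 0; x, ϖ ^ (2 * j + 1), 0; 0, 0, 1] : Matrix (Fin 3) (Fin 3) K)) := by
  have hϖ0 : ϖ ≠ 0 := fun h0 => by rw [h0, map_zero] at hϖ; exact WithZero.coe_ne_zero hϖ.symm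
  have hϖ1 : Valued.v ϖ ≤ 1 := by rw [hϖ, ← WithZero.exp_zero, WithZero.exp_le_exp]; norm_num
  have hvϖ0 : Valued.v ϖ ≠ 0 := (Valuation.ne_zero_iff _).2 hϖ0
  have hvd₁p : Valued.v (((ϖ * σ ϖ) ^ j)⁻¹ : K) * Valued.v (ϖ ^ (2 * j + 1)) = Valued.v ϖ := by
    rw [map_inv₀, map_pow, map_mul, hvσ, ← sq, map_pow, ← pow_mul, pow_succ, ← mul_assoc, inv_mul_cancel₀ (pow_ne_zero _ hvϖ0), one_mul]
  have hG : formCongr σ (Matrix.GeneralLinearGroup.mkOfDetNeZero _ (det_axis3_ne_zero hϖ0 x (2 * j + 1))) (Matrix.diagonal ![-(σ x * ((ϖ * σ ϖ) ^ j)⁻¹ * x), ((ϖ * σ ϖ) ^ j)⁻¹, 1]) =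
      !![0, σ x * ((ϖ * σ ϖ) ^ j)⁻¹ * ϖ ^ (2 * j + 1), 0; σ (ϖ ^ (2 * j + 1)) * ((ϖ * σ ϖ) ^ j)⁻¹ * x, σ (ϖ ^ (2 * j + 1)) * ((ϖ * σ ϖ) ^ j)⁻¹ * ϖ ^ (2 * j + 1), 0; 0, 0, 1] := by
    rw [formCongr_hnf_diagonal σ _ x 0 0 (ϖ ^ (2 * j + 1)) 1 _ rfl]
    ext i k
    fin_cases i <;> fin_cases k <;> simp
  refine isVertexLattice_two_of_gram_eq_block₃ hϖ0 hϖ1 _ hG ?_ ?_ ?_ (map_one _)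
  · rw [map_mul, map_mul, hvσ, hx, one_mul, hvd₁p]
  · rw [map_mul, map_mul, hvσ, hx, mul_one, mul_comm, hvd₁p]
  · rw [map_mul, map_mul, hvσ, mul_comm (Valued.v (ϖ ^ (2 * j + 1))) (Valued.v (((ϖ * σ ϖ) ^ j)⁻¹ : K)), mul_assoc, mul_comm (Valued.v (ϖ ^ (2 * j + 1))),
      ← mul_assoc, hvd₁p, map_pow]
    exact mul_le_of_le_one_right' (pow_le_one' hϖ1 _)

end Summit.HodgeConjecture.HodgeConjecture.Cruxes.H413.F0P3cDyRamDiagonalKappaSplitCountTwoEval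

end
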